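import Mathlib.RingTheory.Ideal.KrullsHeightTheorem
import Mathlib.RingTheory.Ideal.GoingDown
import Mathlib.RingTheory.Ideal.GoingUp
import Mathlib.RingTheory.Ideal.Height
import HarnessLib

/-!
# Crux `FrobeniusLadder.FRationalResolution` (stmt-ResolutionOfSingularities-15317), line `redirect`,
# stub `stub_diagonalizableQuotientResolution` — census item R3-p (descent step, dimension part):
# local dimensions are preserved along an INTEGRAL FLAT extension (the Kummer cover
# `Spec S^{(B)} → Spec S₀`, finite free, at every prime)

Kato's condition (2.1)(ii) for `Spec S₀` at a point `𝔮` is a dimension count; to descend it from the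
finite free cover `S₀ → S^{(B)}` (`…UnitBasisEtale`, `…CoarseningEtale`; wild points included, where
the cover is inseparable) one needs `dim (S^{(B)})_{𝔔'} = dim (S₀)_𝔮` for `𝔔'` over `𝔮`. This file
proves it for any integral flat extension of a Noetherian ring, from Mathlib's dimension formula
under going-down (`Ideal.height_eq_height_add_of_liesOver_of_hasGoingDown`, Matsumura 13.B
Thm. 19) and incomparability (`Ideal.IsIntegral.comap_lt_comap`):

* `height_map_quotient_eq_zero_of_isIntegral` — for `S` integral over `R` and `P` over `p`, the
  image of `P` in the fibre ring `S ⧸ pS` is a minimal prime (height `0`);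
* `height_eq_of_flat_of_isIntegral` — `height P = height p` (`R`, `S` Noetherian, `S` flat and integral);
* `ringKrullDim_atPrime_eq_of_flat_of_isIntegral` — **`dim S_P = dim R_p`**.

Honest label: brick of R3-p (no stub closed). No definitions, no named facts, no sorry.
[cite: Matsumura1987, Thm. 15.1 and §9 (going-up / going-down)] [folklore]
-/

noncomputable section

-- single-problem summit: the doubled namespace component is forced
set_option linter.dupNamespace false

namespace Summit.ResolutionOfSingularities.ResolutionOfSingularities.Theorems.FRationalResolution.FiniteFlatDimension

universe u v

variable {R : Type u} {S : Type v} [CommRing R] [CommRing S] [Algebra R S]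

/-- **The fibre of an integral extension is zero-dimensional at every prime**: for `S` integral
over `R` and a prime `P` of `S` over `p`, the image of `P` in `S ⧸ pS` is a minimal prime, i.e. has
height `0` (incomparability). [cite: Matsumura1987, Thm. 9.3 (ii)] -/
theorem height_map_quotient_eq_zero_of_isIntegral [Algebra.IsIntegral R S] (p : Ideal R)
    [p.IsPrime] (P : Ideal S) [hP : P.IsPrime] [hPp : P.LiesOver p] :
    (P.map (Ideal.Quotient.mk (p.map (algebraMap R S)))).height = 0 := by
  set π := Ideal.Quotient.mk (p.map (algebraMap R S)) with hπ
  have hπsurj : Function.Surjective π := Ideal.Quotient.mk_surjective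
  have hker : RingHom.ker π ≤ P := by
    rw [hπ, Ideal.mk_ker, Ideal.map_le_iff_le_comap, hPp.over]
  haveI hprime : (P.map π).IsPrime := Ideal.map_isPrime_of_surjective hπsurj hker
  have hcomap : (P.map π).comap π = P := by
    rw [Ideal.comap_map_of_surjective _ hπsurj, sup_eq_left.2]
    rintro x hx
    exact hker hx
  rw [Ideal.height_eq_zero_iff]
  refine ⟨⟨hprime, bot_le⟩, fun Q ⟨hQ, _⟩ hQP => ?_⟩
  -- `Q.comap π ≤ P`, both over `p`; incomparability forces equality
  haveI := hQ
  have hle : Q.comap π ≤ P := by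
    have h := Ideal.comap_mono (f := π) hQP
    rwa [hcomap] at h
  rcases hle.lt_or_eq with hlt | heq
  · exfalso
    have h1 : (Q.comap π).comap (algebraMap R S) < P.comap (algebraMap R S) :=
      Ideal.IsIntegral.comap_lt_comap hlt
    have h2 : p ≤ (Q.comap π).comap (algebraMap R S) := by
      intro r hr
      rw [Ideal.mem_comap, Ideal.mem_comap]
      have : algebraMap R S r ∈ RingHom.ker π := by
        rw [hπ, Ideal.mk_ker]; exact Ideal.mem_map_of_mem _ hr
      rw [RingHom.mem_ker] at this
      rw [this]; exact Q.zero_mem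
    have h3 : P.comap (algebraMap R S) = p := by rw [hPp.over]
    rw [h3] at h1
    exact absurd (lt_of_le_of_lt h2 h1) (lt_irrefl _)
  · have : P.map π = Q := by rw [← heq, Ideal.map_comap_of_surjective _ hπsurj]
    exact this.le

/-- **Heights are preserved along an integral flat extension** (Noetherian top): for `P` over `p`,
`height P = height p` (dimension formula under going-down + zero-dimensional integral fibres).
[cite: Matsumura1987, Thm. 15.1] -/
theorem height_eq_of_flat_of_isIntegral [IsNoetherianRing R] [IsNoetherianRing S] [Module.Flat R S]
    [Algebra.IsIntegral R S] (p : Ideal R) [p.IsPrime] (P : Ideal S) [P.IsPrime] [P.LiesOver p] :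
    P.height = p.height := by
  rw [Ideal.height_eq_height_add_of_liesOver_of_hasGoingDown p P,
    height_map_quotient_eq_zero_of_isIntegral p P, add_zero]

/-- **Local dimensions are preserved along an integral flat extension**: for `S` Noetherian, flat
and integral over `R` (e.g. finite free — the Kummer cover `S₀ → S^{(B)}`), a prime `P` of `S` over
`p`, and any localizations `S_P`, `R_p`: `dim S_P = dim R_p`. [cite: Matsumura1987, Thm. 15.1] -/
theorem ringKrullDim_atPrime_eq_of_flat_of_isIntegral [IsNoetherianRing R] [IsNoetherianRing S]
    [Module.Flat R S]
    [Algebra.IsIntegral R S] (p : Ideal R) [p.IsPrime] (P : Ideal S) [P.IsPrime] [P.LiesOver p]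
    (Rp : Type*) [CommRing Rp] [Algebra R Rp] [IsLocalization.AtPrime Rp p]
    (Sp : Type*) [CommRing Sp] [Algebra S Sp] [IsLocalization.AtPrime Sp P] :
    ringKrullDim Sp = ringKrullDim Rp := by
  rw [IsLocalization.AtPrime.ringKrullDim_eq_height P Sp,
    IsLocalization.AtPrime.ringKrullDim_eq_height p Rp, height_eq_of_flat_of_isIntegral p P]

end Summit.ResolutionOfSingularities.ResolutionOfSingularities.Theorems.FRationalResolution.FiniteFlatDimension

end
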